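import Summits.NavierStokesRegularity.NavierStokesRegularity.Theorems.StrainDoorsNearFieldEnergy
import Literature.Analysis.FluidPDE.NewtonLocalPotentialCalculus
import Literature.Analysis.FluidPDE.TaoY6KernelNorms
import Literature.Analysis.FluidPDE.SpaceTimeCalculusC1
import Summits.NavierStokesRegularity.NavierStokesRegularity.Theorems.StrainDoorsPressureSource
import HarnessLib

/-!
# StrainDoorsLocalNewton — door D8 «LocalNewtonParityDoor» (nsreg-p1 g33 ROUND-45; r43/Sketch47.lean v8 8d280076c2be820d §12 VERBATIM
# + one §11 helper): the LOCAL Green representation of the pressure Hessian at scales `0 < r₀ < r₁`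
Over the tree's `StrainDoorsNearField{Defs,Closers,Energy}` (R43/44) and `Literature…NewtonLocalPotential(Calculus)` (`N = Γ₀ ⋆ ·`,
`Λ = λ ⋆ ·`, Green `g = N[Δg] + Λ[g]`, no support/decay hypothesis): `newtonNearFeed`, `smoothingTerm`, door `LocalNewtonParityDoor`,
plates `LocalNewtonSplits` (R, ★ PROVED `localNewtonSplits_holds`, every `t`, gauge-free) / `SmoothingBudget` (B), B1/B2, atoms B3
`HessSmoothingEnergyBound` (NS-free, OPEN) / B4 `SmoothingTermContinuousInTime` (★ PROVED), `le_of_gauge_ae`, `smoothingBudget_of`,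
★★★ `localNewtonParityDoor_of_B3 : HessSmoothingEnergyBound → LocalNewtonParityDoor`. Landed by the S-door LEAD (ns-s30-p1 g4),
`--supports stmt-NavierStokesRegularity-0056 --as helper`. HONEST FRAME: D8 is a CONDITIONAL continuation criterion about hypothetical
blow-up (modulo B3 and the near-field parity hypothesis); 0056 `NoTypeII` / 10661 / NS regularity NOT proved; not a route.
-/
noncomputable section

open MeasureTheory Set Function Filter Metric Real InnerProductSpace
open _root_.Topology
open scoped ENNReal NNReal RealInnerProductSpace ContDiff Laplacian Interval
open Literature.Analysis Literature.Analysis.FluidPDE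
open Literature.Analysis.FluidPDE.VorticityDirectionDynamics

set_option linter.dupNamespace false
namespace Summit.NavierStokesRegularity.NavierStokesRegularity.Theorems.StrainDoors

/-! One helper of Sketch47 v8 §11 used by §12 (the a.e.-→-everywhere upgrade on a slab), verbatim. -/
/-- a.e.-→-everywhere upgrade on a slab: a function continuous on `[0,T)` that vanishes for a.e. `τ ∈ [0,T']`, `T' < T`, vanishes at
every `t ∈ [0,T')` (every right-neighbourhood `[t, t+ε) ∩ [0,T']` has positive Lebesgue measure). -/
theorem eq_zero_of_ae_restrict_Icc_of_continuousOn_Ico {D : ℝ → ℝ} {T T' t : ℝ} (hD : ContinuousOn D (Ico 0 T))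
    (hT'T : T' < T) (hae : ∀ᵐ τ ∂(volume.restrict (Icc 0 T')), D τ = 0) (ht : t ∈ Ico 0 T') : D t = 0 := by
  by_contra hne
  have htT : t ∈ Ico 0 T := ⟨ht.1, ht.2.trans hT'T⟩
  have hev : ∀ᶠ τ in 𝓝[Ico 0 T] t, D τ ≠ 0 := (hD t htT).eventually_ne hne
  obtain ⟨ε, hε, hball⟩ := Metric.mem_nhdsWithin_iff.mp hev
  -- the window `A = [t, min (t+ε) T')` lies in the ball, in `[0,T)` and in `[0,T']`, and has positive measure
  set A : Set ℝ := Ico t (min (t + ε) T') with hA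
  have hApos : 0 < volume A := by
    rw [hA, Real.volume_Ico]; exact ENNReal.ofReal_pos.mpr (by rw [sub_pos, lt_min_iff]; exact ⟨by linarith, ht.2⟩)
  have hAsub : A ⊆ {τ | D τ ≠ 0} := by
    intro τ hτ
    refine hball ⟨?_, ⟨ht.1.trans hτ.1, (lt_of_lt_of_le hτ.2 (min_le_right _ _)).trans hT'T⟩⟩
    rw [Metric.mem_ball, Real.dist_eq, abs_lt]
    exact ⟨by linarith [hτ.1], by linarith [lt_of_lt_of_le hτ.2 (min_le_left _ _)]⟩
  have hAT' : A ⊆ Icc 0 T' := fun τ hτ => ⟨ht.1.trans hτ.1, (lt_of_lt_of_le hτ.2 (min_le_right _ _)).le⟩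
  have hnull : (volume.restrict (Icc 0 T')) {τ | D τ ≠ 0} = 0 := by
    have := ae_iff.mp hae; simpa using this
  have hzero : (volume.restrict (Icc 0 T')) A = 0 := measure_mono_null hAsub hnull
  rw [Measure.restrict_apply measurableSet_Ico, inter_eq_left.mpr hAT'] at hzero
  exact hApos.ne' hzero

/-! ## §12 DOOR D8 «LocalNewtonParityDoor» (ROUND-45): the LOCAL Green representation of the pressure Hessian at scales
`0 < r₀ < r₁` — `p_ee(t,x) = N_{r₀r₁}[∂ₑ∂ₑ q(t)](x) + ∫ ∂ₑλ(z) ∂ₑp(t)(x − z) dz` with `N = Γ₀ ⋆` (`Γ₀ = θΓ`, tree `newtonNearPotential`),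
`λ = Δ((1−θ)Γ)` (tree `newtonFarLaplacian`, smooth, supported in the shell `r₀ ≤ |z| ≤ r₁`) and `q = Δp = |ω|² − |∇u|²` — holds at EVERY
`t`, is GAUGE-FREE, and is PROVED below (plate R `localNewtonSplits_holds`) from the tree's `fderiv_eq_fderiv_newtonNearPotential_add`,
`fderiv_fderiv_newtonNearPotential_apply`, `fderiv_newtonFarSmoothing_apply_eq_integral`, `fderiv_integral_smul_comp_sub_apply` and
`qDensity_eq_laplacian_pressure` (route-independent twin of `laplacian_pressure_eq_of_mem_Ico`). The near term is PRESSURE-FREE; the pressure enters only the SMOOTHING TERM, whose energy-class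
BUDGET (plate B) is where the a.e.-`t` gauge `p = ϖ(u) + C(t)` is used. -/

/-- the PRESSURE-FREE near feed at scales `(r₀,r₁)`: `¼(|ω|² − ω_e²) − N_{r₀r₁}[∂ₑ∂ₑ q(t)](x)`, `q = |ω|² − |∇u|² = ½|ω|² − |S|²` (`qDensity`). -/
def newtonNearFeed (r₀ r₁ : ℝ) (u : ℝ → (EuclideanSpace ℝ (Fin 3)) → (EuclideanSpace ℝ (Fin 3))) (t : ℝ)
    (x e : EuclideanSpace ℝ (Fin 3)) : ℝ :=
  (1 / 4) * (‖curl (u t) x‖ ^ 2 - ⟪curl (u t) x, e⟫ ^ 2) -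
    newtonNearPotential r₀ r₁ (fun w => fderiv ℝ (fun y => fderiv ℝ (qDensity u t) y e) w e) x

/-- the SMOOTHING TERM (gradient level, the only place the pressure enters): `∫ ∂ₑλ(z) ∂ₑp(t)(x − z) dz = ∂ₑΛ[∂ₑp(t)](x)`. -/
def smoothingTerm (r₀ r₁ : ℝ) (p : ℝ → (EuclideanSpace ℝ (Fin 3)) → ℝ) (t : ℝ) (x e : EuclideanSpace ℝ (Fin 3)) : ℝ :=
  ∫ z, fderiv ℝ (newtonFarLaplacian r₀ r₁) z e * fderiv ℝ (p t) (x - z) e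

/-- DOOR D8 «LocalNewtonParityDoor» (scales `0 < r₀ < r₁` fixed): if on `[t₀,T)` at every `δ`-almost strain maximiser above level `l₀`
the PRESSURE-FREE LOCAL near feed is at most `λ_max²`, the solution continues past `T`. -/
def LocalNewtonParityDoor : Prop :=
  ∀ (ν T t₀ l₀ δ r₀ r₁ : ℝ), 0 < ν → 0 ≤ t₀ → t₀ < T → 0 < l₀ → 0 < δ → δ < 1 → 0 < r₀ → r₀ < r₁ →
    ∀ (u : ℝ → (EuclideanSpace ℝ (Fin 3)) → (EuclideanSpace ℝ (Fin 3)))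
      (p : ℝ → (EuclideanSpace ℝ (Fin 3)) → ℝ),
      IsClassicalNSSolutionOn (Ico 0 T) ν 0 u p →
      (∀ T'' < T, HasBoundedSobolevNormsOn (Icc 0 T'') u) →
      (∀ t ∈ Ico t₀ T, ∀ (x e : EuclideanSpace ℝ (Fin 3)), IsStrainAlmostArgmax δ u t x e →
        l₀ < strainQuad u t x e → newtonNearFeed r₀ r₁ u t x e ≤ strainQuad u t x e ^ 2) →
      HasSobolevExtensionPast ν u T

/-- PLATE R «LocalNewtonSplits» (PROVED below, every `t`, gauge-free): `strainFeed = newtonNearFeed_{r₀r₁} − smoothingTerm_{r₀r₁}`. -/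
def LocalNewtonSplits : Prop :=
  ∀ (ν T : ℝ) (u : ℝ → (EuclideanSpace ℝ (Fin 3)) → (EuclideanSpace ℝ (Fin 3)))
    (p : ℝ → (EuclideanSpace ℝ (Fin 3)) → ℝ), 0 < ν →
    IsClassicalNSSolutionOn (Ico 0 T) ν 0 u p →
    (∀ T'' < T, HasBoundedSobolevNormsOn (Icc 0 T'') u) →
    ∀ t ∈ Ico 0 T, ∀ (r₀ r₁ : ℝ), 0 < r₀ → r₀ < r₁ → ∀ (x e : EuclideanSpace ℝ (Fin 3)),
      strainFeed u p t x e = newtonNearFeed r₀ r₁ u t x e - smoothingTerm r₀ r₁ p t x e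

/-- PLATE B «SmoothingBudget» (energy class, via the a.e.-`t` gauge): the smoothing term has a time-integrable budget on `[t₀,T)`. -/
def SmoothingBudget : Prop :=
  ∀ (ν T t₀ r₀ r₁ : ℝ) (u : ℝ → (EuclideanSpace ℝ (Fin 3)) → (EuclideanSpace ℝ (Fin 3)))
    (p : ℝ → (EuclideanSpace ℝ (Fin 3)) → ℝ), 0 < ν → 0 ≤ t₀ → t₀ < T → 0 < r₀ → r₀ < r₁ →
    IsClassicalNSSolutionOn (Ico 0 T) ν 0 u p →
    (∀ T'' < T, HasBoundedSobolevNormsOn (Icc 0 T'') u) →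
    ∃ (β : ℝ) (Φ b : ℝ → ℝ), Φ t₀ = 0 ∧ (∀ t ∈ Ico t₀ T, 0 ≤ Φ t ∧ Φ t ≤ β ∧ HasDerivAt Φ (b t) t) ∧
      ∀ t ∈ Ico t₀ T, ∀ (x e : EuclideanSpace ℝ (Fin 3)), ‖e‖ = 1 → |smoothingTerm r₀ r₁ p t x e| ≤ b t

/-- D8 from plate R, plate B and D5 (kernel-checked composition). -/
theorem localNewtonParityDoor_of (hR : LocalNewtonSplits) (hB : SmoothingBudget) (hD5 : BudgetedParityDoor) :
    LocalNewtonParityDoor := by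
  intro ν T t₀ l₀ δ r₀ r₁ hν ht₀ hT hl₀ hδ hδ1 hr₀ hr₁ u p hsol hSob hnear
  obtain ⟨β, Φ, b, hΦ0, hΦ, hfar⟩ := hB ν T t₀ r₀ r₁ u p hν ht₀ hT hr₀ hr₁ hsol hSob
  refine hD5 ν T t₀ l₀ δ (β / l₀) (fun t => Φ t / l₀) (fun t => b t / l₀) hν ht₀ hT hl₀.le hδ hδ1
    (by simp [hΦ0]) ?_ u p hsol hSob ?_
  · intro t ht
    obtain ⟨h0, hβ, hd⟩ := hΦ t ht
    exact ⟨div_nonneg h0 hl₀.le, div_le_div_of_nonneg_right hβ hl₀.le, hd.div_const l₀⟩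
  · intro t ht x e hax hq
    have he : ‖e‖ = 1 := hax.1
    have ht' : t ∈ Ico 0 T := ⟨ht₀.trans ht.1, ht.2⟩
    have hsplit := hR ν T u p hν hsol hSob t ht' r₀ r₁ hr₀ hr₁ x e
    have hfb := hfar t ht x e he
    have hn := hnear t ht x e hax hq
    have h1 : -smoothingTerm r₀ r₁ p t x e ≤ b t := le_trans (neg_le_abs _) hfb
    have hb0 : 0 ≤ b t := le_trans (abs_nonneg _) hfb
    have h2 : b t ≤ b t / l₀ * strainQuad u t x e := by
      rw [div_mul_eq_mul_div, le_div_iff₀ hl₀]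
      exact mul_le_mul_of_nonneg_left hq.le hb0
    rw [hsplit]
    linarith

/-- D8 from the two plates over the tree's D5. -/
theorem localNewtonParityDoor_of_plates (hR : LocalNewtonSplits) (hB : SmoothingBudget) : LocalNewtonParityDoor :=
  localNewtonParityDoor_of hR hB budgetedParityDoor_holds

/-! ### Plate R PROVED -/

/-- the Hessian form `⟪D(∇P)(x) e, e⟫` is the iterated directional derivative `∂ₑ(∂ₑP)(x)`. -/
theorem inner_fderiv_gradient_eq {P : (EuclideanSpace ℝ (Fin 3)) → ℝ} (hP : ContDiff ℝ 2 P) (x e : EuclideanSpace ℝ (Fin 3)) :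
    ⟪fderiv ℝ (gradient P) x e, e⟫ = fderiv ℝ (fun y => fderiv ℝ P y e) x e := by
  have hd1 : ContDiff ℝ 1 (fderiv ℝ P) := hP.fderiv_right (by norm_num)
  have hdiff : DifferentiableAt ℝ (fderiv ℝ P) x := (hd1.differentiable one_ne_zero).differentiableAt
  have hg : gradient P = fun y => (InnerProductSpace.toDual ℝ (EuclideanSpace ℝ (Fin 3))).symm (fderiv ℝ P y) := by
    funext y; rfl
  have h1 : fderiv ℝ (gradient P) x e =
      (InnerProductSpace.toDual ℝ (EuclideanSpace ℝ (Fin 3))).symm (fderiv ℝ (fderiv ℝ P) x e) := by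
    rw [hg]
    have hc : HasFDerivAt (fun y => (InnerProductSpace.toDual ℝ (EuclideanSpace ℝ (Fin 3))).symm (fderiv ℝ P y))
        (((InnerProductSpace.toDual ℝ (EuclideanSpace ℝ (Fin 3))).symm.toContinuousLinearEquiv :
          _ →L[ℝ] (EuclideanSpace ℝ (Fin 3))).comp (fderiv ℝ (fderiv ℝ P) x)) x :=
      (InnerProductSpace.toDual ℝ (EuclideanSpace ℝ (Fin 3))).symm.toContinuousLinearEquiv.hasFDerivAt.comp x
        hdiff.hasFDerivAt
    rw [hc.fderiv]; rfl
  have h2 : fderiv ℝ (fun y => fderiv ℝ P y e) x e = fderiv ℝ (fderiv ℝ P) x e e := by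
    rw [fderiv_clm_apply hdiff (differentiableAt_const e)]
    simp
  rw [h1, h2, InnerProductSpace.toDual_symm_apply]

/-- ★ PLATE R PROVED: `localNewtonSplits_holds : LocalNewtonSplits`. -/
theorem localNewtonSplits_holds : LocalNewtonSplits := by
  intro ν T u p hν hsol hSob t ht r₀ r₁ hr₀ hr₁ x e
  have hS : UniqueDiffOn ℝ (Ico (0 : ℝ) T) := uniqueDiffOn_Ico 0 T
  have hps : ContDiff ℝ ∞ (p t) := hsol.smooth_pressure.contDiff_slice ht
  have hΔs : ContDiff ℝ ∞ (fun y => (Δ (p t)) y) := (hsol.smooth_pressure.laplacian hS).contDiff_slice ht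
  have hp2 : ContDiff ℝ 2 (p t) := contDiff_infty.1 hps 2
  have hΔ1 : ContDiff ℝ 1 (fun y => (Δ (p t)) y) := contDiff_infty.1 hΔs 1
  have hΔ2 : ContDiff ℝ 2 (fun y => (Δ (p t)) y) := contDiff_infty.1 hΔs 2
  -- `q = Δp` as functions (pressure Poisson equation in the frame, every `t`)
  have hq : qDensity u t = fun y => (Δ (p t)) y := qDensity_eq_laplacian_pressure_fun hsol ht
  -- the local Green representation at gradient level, at every point
  set N : (EuclideanSpace ℝ (Fin 3)) → ℝ := newtonNearPotential r₀ r₁ (fun y => (Δ (p t)) y) with hN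
  set L : (EuclideanSpace ℝ (Fin 3)) → ℝ := newtonFarSmoothing r₀ r₁ (p t) with hL
  have hgrad : ∀ y, fderiv ℝ (p t) y = fderiv ℝ N y + fderiv ℝ L y := fun y =>
    fderiv_eq_fderiv_newtonNearPotential_add hr₀ hr₁ one_pos hp2 hΔ1 (x := y) (fun _ _ => rfl)
  have hfun : (fun y => fderiv ℝ (p t) y e) = fun y => fderiv ℝ N y e + fderiv ℝ L y e := by
    funext y; rw [hgrad y]; rfl
  -- differentiability of the two pieces along `e`
  have hNs : ContDiff ℝ 2 N := contDiff_newtonNearPotential hr₀.le hr₁ 2 hΔ2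
  have hLs : ContDiff ℝ 2 L := contDiff_newtonFarSmoothing hr₀ hr₁ 2 hp2
  have hNe : Differentiable ℝ (fun y => fderiv ℝ N y e) :=
    ((hNs.fderiv_right (by norm_num)).clm_apply contDiff_const).differentiable one_ne_zero
  have hLe : Differentiable ℝ (fun y => fderiv ℝ L y e) :=
    ((hLs.fderiv_right (by norm_num)).clm_apply contDiff_const).differentiable one_ne_zero
  -- the Hessian entry
  have hH : pressureHess p t x e = fderiv ℝ (fun y => fderiv ℝ N y e) x e + fderiv ℝ (fun y => fderiv ℝ L y e) x e := by
    unfold pressureHess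
    rw [inner_fderiv_gradient_eq hp2, hfun,
      show (fun y => fderiv ℝ N y e + fderiv ℝ L y e) = ((fun y => fderiv ℝ N y e) + fun y => fderiv ℝ L y e) from rfl,
      fderiv_add (hNe x) (hLe x)]; rfl
  -- near piece: `∂ₑ∂ₑN[Δp] = N[∂ₑ∂ₑΔp]`
  have hnearEq : fderiv ℝ (fun y => fderiv ℝ N y e) x e =
      newtonNearPotential r₀ r₁ (fun w => fderiv ℝ (fun y => fderiv ℝ (qDensity u t) y e) w e) x := by
    rw [hN, fderiv_fderiv_newtonNearPotential_apply hr₀.le hr₁ hΔ2 x e e, hq]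
  -- smoothing piece: `∂ₑ(∂ₑΛ[p]) = ∫ ∂ₑλ(z) ∂ₑp(x − z) dz`
  have hLfun : (fun y => fderiv ℝ L y e) = fun y => ∫ z, (fderiv ℝ (newtonFarLaplacian r₀ r₁) z e) • (p t) (y - z) := by
    funext y
    rw [hL, fderiv_newtonFarSmoothing_apply_eq_integral hr₀ hr₁ (contDiff_infty.1 hps 1) y e]
    simp only [smul_eq_mul]
  have hk : Integrable (fun z => fderiv ℝ (newtonFarLaplacian r₀ r₁) z e) :=
    ((continuous_fderiv_newtonFarLaplacian hr₀ hr₁).clm_apply continuous_const).integrable_of_hasCompactSupport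
      ((hasCompactSupport_fderiv_newtonFarLaplacian hr₀ hr₁).mono fun z hz h0 =>
        hz (show fderiv ℝ (newtonFarLaplacian r₀ r₁) z e = 0 by rw [h0]; rfl))
  have hk0 : ∀ z : EuclideanSpace ℝ (Fin 3), r₁ < ‖z‖ → fderiv ℝ (newtonFarLaplacian r₀ r₁) z e = 0 := fun z hz => by
    rw [fderiv_newtonFarLaplacian_eq_zero_of_gt hr₀.le hr₁ hz]; rfl
  have hfarEq : fderiv ℝ (fun y => fderiv ℝ L y e) x e = smoothingTerm r₀ r₁ p t x e := by
    rw [hLfun, fderiv_integral_smul_comp_sub_apply hk hk0 (contDiff_infty.1 hps 1) x e]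
    simp only [smoothingTerm, smul_eq_mul]
  -- assemble
  unfold strainFeed newtonNearFeed
  rw [hH, hnearEq, hfarEq]; ring

/-- ★★ D8 CLOSED MODULO PLATE B ALONE: `SmoothingBudget → LocalNewtonParityDoor`. -/
theorem localNewtonParityDoor_of_budget (hB : SmoothingBudget) : LocalNewtonParityDoor :=
  localNewtonParityDoor_of_plates localNewtonSplits_holds hB


/-! ### Plate B reduced to two NS-free atoms B3 (fixed-time harmonic analysis) and B4 (continuity in `t`); B1, B2 and the
a.e.-gauge assembly PROVED -/

/-- the Hessian smoothing kernel `λ_ee(z) = ∂ₑ∂ₑλ(z)` (smooth, supported in the shell `r₀ ≤ |z| ≤ r₁`, mean zero). -/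
def smoothingHessKernel (r₀ r₁ : ℝ) (e z : EuclideanSpace ℝ (Fin 3)) : ℝ :=
  fderiv ℝ (fun w => fderiv ℝ (newtonFarLaplacian r₀ r₁) w e) z e

/-- `z ↦ ∂ₑλ(z)` is `C¹`. -/
theorem contDiff_fderiv_newtonFarLaplacian_apply {r₀ r₁ : ℝ} (hr₀ : 0 < r₀) (hr₁ : r₀ < r₁) (e : EuclideanSpace ℝ (Fin 3)) :
    ContDiff ℝ 1 (fun w => fderiv ℝ (newtonFarLaplacian r₀ r₁) w e) :=
  ((contDiff_newtonFarLaplacian hr₀ hr₁ (n := 2)).fderiv_right (by norm_num)).clm_apply contDiff_const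

/-- `z ↦ ∂ₑλ(z)` has compact support. -/
theorem hasCompactSupport_fderiv_newtonFarLaplacian_apply {r₀ r₁ : ℝ} (hr₀ : 0 < r₀) (hr₁ : r₀ < r₁)
    (e : EuclideanSpace ℝ (Fin 3)) : HasCompactSupport (fun w => fderiv ℝ (newtonFarLaplacian r₀ r₁) w e) :=
  (hasCompactSupport_fderiv_newtonFarLaplacian hr₀ hr₁).mono fun z hz h0 =>
    hz (show fderiv ℝ (newtonFarLaplacian r₀ r₁) z e = 0 by rw [h0]; rfl)

/-- B1 (PROVED): one more integration by parts puts the smoothing term at PRESSURE level: `∫ ∂ₑλ(z) ∂ₑP(x−z) dz = ∫ λ_ee(z) P(x−z) dz`. -/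
theorem smoothingTerm_eq_integral_hessKernel {r₀ r₁ : ℝ} (hr₀ : 0 < r₀) (hr₁ : r₀ < r₁)
    {p : ℝ → (EuclideanSpace ℝ (Fin 3)) → ℝ} {t : ℝ} (hP : ContDiff ℝ 1 (p t)) (x e : EuclideanSpace ℝ (Fin 3)) :
    smoothingTerm r₀ r₁ p t x e = ∫ z, smoothingHessKernel r₀ r₁ e z * p t (x - z) := by
  unfold smoothingTerm smoothingHessKernel
  exact (integral_fderiv_mul_comp_sub (contDiff_fderiv_newtonFarLaplacian_apply hr₀ hr₁ e)
    (hasCompactSupport_fderiv_newtonFarLaplacian_apply hr₀ hr₁ e) hP x e).symm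

/-- B2 (PROVED): the Hessian smoothing kernel has MEAN ZERO, `∫ λ_ee = 0` — so it does not see the gauge constant `C(t)`. -/
theorem integral_smoothingHessKernel {r₀ r₁ : ℝ} (hr₀ : 0 < r₀) (hr₁ : r₀ < r₁) (e : EuclideanSpace ℝ (Fin 3)) :
    ∫ z, smoothingHessKernel r₀ r₁ e z = 0 := by
  have h := integral_fderiv_mul_comp_sub (contDiff_fderiv_newtonFarLaplacian_apply hr₀ hr₁ e)
    (hasCompactSupport_fderiv_newtonFarLaplacian_apply hr₀ hr₁ e) (contDiff_const (c := (1 : ℝ))) 0 e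
  unfold smoothingHessKernel
  simpa using h

/-- atom B3 «HessSmoothingEnergyBound» (fixed-time harmonic analysis, NO Navier–Stokes): the Hessian-smoothed normalised pressure of
an `H^∞` field is bounded by ENERGY + ENSTROPHY: `|∫ λ_ee(z) ϖ(v)(x−z) dz| ≤ C(r₀,r₁)(‖v‖₂² + ‖∇v‖₂²)` — from Hölder `L³ × L^{3/2}`,
the Calderón–Zygmund bound `‖ϖ(v)‖_{3/2} ≲ ‖v‖₃²` (tree `exists_eLpNorm_normalisedPressure_le_sq`, `p = 3/2`), the interpolation
`‖v‖₃² ≤ ‖v‖₂‖v‖₆`, the Sobolev inequality `‖v‖₆ ≲ ‖∇v‖₂` (tree `exists_eLpNorm_six_le_of_hasWeakGradient_euclidean`) and `ab ≤ (a²+b²)/2`. -/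
def HessSmoothingEnergyBound : Prop :=
  ∀ (r₀ r₁ : ℝ), 0 < r₀ → r₀ < r₁ → ∃ C : ℝ, 0 ≤ C ∧
    ∀ (v : (EuclideanSpace ℝ (Fin 3)) → (EuclideanSpace ℝ (Fin 3))),
      ContDiff ℝ ∞ v → (∀ n : ℕ, ∫⁻ x, ‖iteratedFDeriv ℝ n v x‖ₑ ^ 2 < ⊤) →
      ∀ (x e : EuclideanSpace ℝ (Fin 3)), ‖e‖ = 1 →
        |∫ z, smoothingHessKernel r₀ r₁ e z * normalisedPressure v (x - z)| ≤
          C * ((∫ y, ‖v y‖ ^ 2) + VectorCalculus.gradNormSq v)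

/-- atom B4 «SmoothingTermContinuousInTime»: in the door frame the smoothing term is continuous in `t` on `[0,T)` for fixed `x, e`
(dominated convergence: `∂ₑλ` is continuous with compact support and `∇p` is jointly continuous). -/
def SmoothingTermContinuousInTime : Prop :=
  ∀ (ν T : ℝ) (u : ℝ → (EuclideanSpace ℝ (Fin 3)) → (EuclideanSpace ℝ (Fin 3)))
    (p : ℝ → (EuclideanSpace ℝ (Fin 3)) → ℝ), 0 < ν →
    IsClassicalNSSolutionOn (Ico 0 T) ν 0 u p →
    (∀ T'' < T, HasBoundedSobolevNormsOn (Icc 0 T'') u) →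
    ∀ (r₀ r₁ : ℝ), 0 < r₀ → r₀ < r₁ → ∀ (x e : EuclideanSpace ℝ (Fin 3)),
      ContinuousOn (fun t => smoothingTerm r₀ r₁ p t x e) (Ico 0 T)

/-- the a.e.-gauge upgrade engine, INEQUALITY form: an estimate `F ≤ G` between time-continuous quantities that holds whenever
`p(τ) = ϖ(u τ) + C` pointwise holds at EVERY `t ∈ [0,T)` (gauge for a.e. `τ` by `tao_pressure_normalisation_holds`). -/
theorem le_of_gauge_ae {ν T : ℝ} {u : ℝ → (EuclideanSpace ℝ (Fin 3)) → (EuclideanSpace ℝ (Fin 3))}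
    {p : ℝ → (EuclideanSpace ℝ (Fin 3)) → ℝ} (hν : 0 < ν) (hsol : IsClassicalNSSolutionOn (Ico 0 T) ν 0 u p)
    (hSob : ∀ T'' < T, HasBoundedSobolevNormsOn (Icc 0 T'') u) (F G : ℝ → ℝ) (hF : ContinuousOn F (Ico 0 T))
    (hG : ContinuousOn G (Ico 0 T))
    (hfix : ∀ τ ∈ Ico 0 T, ∀ C : ℝ, (∀ y, p τ y = normalisedPressure (u τ) y + C) → F τ ≤ G τ)
    {t : ℝ} (ht : t ∈ Ico 0 T) : F t ≤ G t := by
  set T' : ℝ := (t + T) / 2 with hT'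
  have hT'T : T' < T := by rw [hT']; linarith [ht.2]
  have htT' : t < T' := by rw [hT']; linarith [ht.2]
  have hT'0 : 0 < T' := lt_of_le_of_lt ht.1 htT'
  have hsolc : IsClassicalNSSolutionOn (Icc 0 T') ν 0 u p := hsol.mono (Icc_subset_Ico_right hT'T) (uniqueDiffOn_Icc hT'0)
  obtain ⟨Cg, -, -, hae⟩ := tao_pressure_normalisation_holds ν T' hν hT'0 u p hsolc (finiteEnergy_of_frame hSob hT'T)
  set D : ℝ → ℝ := fun τ => max (F τ - G τ) 0 with hD
  have hDc : ContinuousOn D (Ico 0 T) := fun τ hτ => ((hF τ hτ).sub (hG τ hτ)).max continuousWithinAt_const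
  have hae' : ∀ᵐ τ ∂(volume.restrict (Icc 0 T')), D τ = 0 := by
    filter_upwards [ae_restrict_mem measurableSet_Icc, hae] with τ hτ hg
    have h := hfix τ ⟨hτ.1, lt_of_le_of_lt hτ.2 hT'T⟩ (Cg τ) hg
    show max (F τ - G τ) 0 = 0
    exact max_eq_right (by linarith)
  have h0 : D t = 0 := eq_zero_of_ae_restrict_Icc_of_continuousOn_Ico hDc hT'T hae' ⟨ht.1, htT'⟩
  have h1 : F t - G t ≤ 0 := by
    have := le_max_left (F t - G t) 0
    rw [show max (F t - G t) 0 = D t from rfl, h0] at this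
    exact this
  linarith

/-- ★ PLATE B from atoms B3 ∧ B4 (with B1, B2, the a.e. gauge, A3′ `energyNonIncreasing_holds`, A3⁺ `dissipationBudget_holds` and A3a
`gradNormSqContinuousOn_holds`, all PROVED): `HessSmoothingEnergyBound → SmoothingTermContinuousInTime → SmoothingBudget`. -/
theorem smoothingBudget_of (h3 : HessSmoothingEnergyBound) (h4 : SmoothingTermContinuousInTime) : SmoothingBudget := by
  intro ν T t₀ r₀ r₁ u p hν ht₀ hT hr₀ hr₁ hsol hSob
  obtain ⟨C, hC0, hC⟩ := h3 r₀ r₁ hr₀ hr₁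
  obtain ⟨βg, Φg, hΦg0, hΦg⟩ := dissipationBudget_holds ν T t₀ u p hν ht₀ hT hsol hSob
  set K : ℝ := ∫ y, ‖u 0 y‖ ^ 2 with hK
  have hK0 : 0 ≤ K := integral_nonneg fun _ => by positivity
  refine ⟨C * (K * T + βg), fun t => C * (K * (t - t₀) + Φg t), fun t => C * (K + VectorCalculus.gradNormSq (u t)),
    by simp [hΦg0], fun t ht => ?_, fun t ht x e he => ?_⟩
  · obtain ⟨hΦ0, hΦβ, hΦd⟩ := hΦg t ht
    refine ⟨mul_nonneg hC0 (add_nonneg (mul_nonneg hK0 (by linarith [ht.1])) hΦ0),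
      mul_le_mul_of_nonneg_left (add_le_add (mul_le_mul_of_nonneg_left (by linarith [ht.2]) hK0) hΦβ) hC0, ?_⟩
    have hd : HasDerivAt (fun t => K * (t - t₀) + Φg t) (K * 1 + VectorCalculus.gradNormSq (u t)) t :=
      (((hasDerivAt_id t).sub_const t₀).const_mul K).add hΦd
    simpa using hd.const_mul C
  · have ht' : t ∈ Ico 0 T := ⟨ht₀.trans ht.1, ht.2⟩
    -- continuity of both sides in `t`
    have hF : ContinuousOn (fun τ => |smoothingTerm r₀ r₁ p τ x e|) (Ico 0 T) :=
      (h4 ν T u p hν hsol hSob r₀ r₁ hr₀ hr₁ x e).abs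
    have hG : ContinuousOn (fun τ => C * (K + VectorCalculus.gradNormSq (u τ))) (Ico 0 T) :=
      continuousOn_const.mul (continuousOn_const.add (gradNormSqContinuousOn_holds ν T u p hν hsol hSob))
    refine le_of_gauge_ae hν hsol hSob _ _ hF hG (fun τ hτ Cτ hg => ?_) ht'
    -- at a gauge time: IBP to pressure level, kill the constant, apply B3, bound the energy by `K`
    have hP1 : ContDiff ℝ 1 (p τ) := contDiff_infty.1 (hsol.smooth_pressure.contDiff_slice hτ) 1
    have hϖc : Continuous (normalisedPressure (u τ)) := by
      have : normalisedPressure (u τ) = fun y => p τ y - Cτ := funext fun y => by rw [hg y]; ring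
      rw [this]; exact hP1.continuous.sub continuous_const
    have hkc : Continuous (smoothingHessKernel r₀ r₁ e) :=
      (contDiff_fderiv_newtonFarLaplacian_apply hr₀ hr₁ e).continuous_fderiv one_ne_zero |>.clm_apply continuous_const
    have hks : HasCompactSupport (smoothingHessKernel r₀ r₁ e) :=
      (hasCompactSupport_fderiv_newtonFarLaplacian_apply hr₀ hr₁ e).fderiv (𝕜 := ℝ) |>.mono fun z hz h0 =>
        hz (show fderiv ℝ (fun w => fderiv ℝ (newtonFarLaplacian r₀ r₁) w e) z e = 0 by rw [h0]; rfl)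
    have hint1 : Integrable fun z => smoothingHessKernel r₀ r₁ e z * normalisedPressure (u τ) (x - z) :=
      (hkc.mul (hϖc.comp (continuous_const.sub continuous_id))).integrable_of_hasCompactSupport hks.mul_right
    have hint2 : Integrable fun z => smoothingHessKernel r₀ r₁ e z * Cτ := (hkc.integrable_of_hasCompactSupport hks).mul_const _
    have hsplit : smoothingTerm r₀ r₁ p τ x e = ∫ z, smoothingHessKernel r₀ r₁ e z * normalisedPressure (u τ) (x - z) := by
      rw [smoothingTerm_eq_integral_hessKernel hr₀ hr₁ hP1 x e]
      have hpt : (fun z => smoothingHessKernel r₀ r₁ e z * p τ (x - z)) =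
          fun z => smoothingHessKernel r₀ r₁ e z * normalisedPressure (u τ) (x - z) + smoothingHessKernel r₀ r₁ e z * Cτ := by
        funext z; rw [hg (x - z)]; ring
      rw [hpt, integral_add hint1 hint2, integral_mul_const, integral_smoothingHessKernel hr₀ hr₁ e, zero_mul, add_zero]
    have hfin : ∀ n : ℕ, ∫⁻ y, ‖iteratedFDeriv ℝ n (u τ) y‖ₑ ^ 2 < ⊤ := fun n => by
      obtain ⟨T'', hτT'', hT''T⟩ := exists_between hτ.2
      obtain ⟨C', hC'⟩ := hSob T'' hT''T n
      exact lt_of_le_of_lt (hC' τ ⟨hτ.1, hτT''.le⟩) ENNReal.coe_lt_top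
    have hB := hC (u τ) (hsol.contDiff_velocity hτ) hfin x e he
    have hE : ∫ y, ‖u τ y‖ ^ 2 ≤ K := by
      have h := energyNonIncreasing_holds ν T u p hν hsol hSob 0 τ le_rfl hτ.1 hτ.2
      unfold VectorCalculus.kineticEnergy at h
      rw [hK]; linarith
    rw [hsplit]
    calc |∫ z, smoothingHessKernel r₀ r₁ e z * normalisedPressure (u τ) (x - z)|
        ≤ C * ((∫ y, ‖u τ y‖ ^ 2) + VectorCalculus.gradNormSq (u τ)) := hB
      _ ≤ C * (K + VectorCalculus.gradNormSq (u τ)) := by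
          exact mul_le_mul_of_nonneg_left (by linarith) hC0

/-- ★★ D8 from the two NS-free atoms: `HessSmoothingEnergyBound → SmoothingTermContinuousInTime → LocalNewtonParityDoor`. -/
theorem localNewtonParityDoor_of_B3_B4 (h3 : HessSmoothingEnergyBound) (h4 : SmoothingTermContinuousInTime) :
    LocalNewtonParityDoor :=
  localNewtonParityDoor_of_budget (smoothingBudget_of h3 h4)


/-- ★ B4 PROVED: the smoothing term is continuous in `t` on `[0,T)` (parametric integral with a uniformly compactly supported,
jointly continuous integrand: Mathlib `continuousOn_integral_of_compact_support` + tree `continuousOn_fderiv_slice_of_contDiffOn`). -/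
theorem smoothingTermContinuousInTime_holds : SmoothingTermContinuousInTime := by
  intro ν T u p hν hsol hSob r₀ r₁ hr₀ hr₁ x e
  by_cases hT : 0 < T
  swap
  · rw [Ico_eq_empty (fun h => hT (lt_of_le_of_lt le_rfl h))]
    exact continuousOn_empty _
  have hk : IsCompact (tsupport fun z => fderiv ℝ (newtonFarLaplacian r₀ r₁) z e) :=
    hasCompactSupport_fderiv_newtonFarLaplacian_apply hr₀ hr₁ e
  have hp1 : ContDiffOn ℝ 1 (Function.uncurry p) (Ico 0 T ×ˢ univ) := contDiffOn_infty.1 hsol.smooth_pressure 1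
  have hsl : ContinuousOn (fun q : ℝ × EuclideanSpace ℝ (Fin 3) => fderiv ℝ (p q.1) q.2) (Ico 0 T ×ˢ univ) :=
    continuousOn_fderiv_slice_of_contDiffOn hp1 (uniqueDiffOn_Ico 0 T)
  have hmap : MapsTo (fun q : ℝ × EuclideanSpace ℝ (Fin 3) => (q.1, x - q.2)) (Ico 0 T ×ˢ univ) (Ico 0 T ×ˢ univ) :=
    fun q hq => ⟨(mem_prod.1 hq).1, mem_univ _⟩
  have hg2 : ContinuousOn (fun q : ℝ × EuclideanSpace ℝ (Fin 3) => fderiv ℝ (p q.1) (x - q.2) e) (Ico 0 T ×ˢ univ) :=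
    ((hsl.comp (continuous_fst.prodMk (continuous_const.sub continuous_snd)).continuousOn hmap).clm_apply
      continuousOn_const)
  have hg1 : Continuous (fun q : ℝ × EuclideanSpace ℝ (Fin 3) => fderiv ℝ (newtonFarLaplacian r₀ r₁) q.2 e) :=
    (contDiff_fderiv_newtonFarLaplacian_apply hr₀ hr₁ e).continuous.comp continuous_snd
  have hf : ContinuousOn (Function.uncurry fun (t : ℝ) (z : EuclideanSpace ℝ (Fin 3)) =>
      fderiv ℝ (newtonFarLaplacian r₀ r₁) z e * fderiv ℝ (p t) (x - z) e) (Ico 0 T ×ˢ univ) :=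
    hg1.continuousOn.mul hg2
  have hfs : ∀ (t : ℝ) (z : EuclideanSpace ℝ (Fin 3)), t ∈ Ico 0 T →
      z ∉ tsupport (fun z => fderiv ℝ (newtonFarLaplacian r₀ r₁) z e) →
      fderiv ℝ (newtonFarLaplacian r₀ r₁) z e * fderiv ℝ (p t) (x - z) e = 0 := fun t z _ hz => by
    rw [show fderiv ℝ (newtonFarLaplacian r₀ r₁) z e = 0 from
      image_eq_zero_of_notMem_tsupport (f := fun z => fderiv ℝ (newtonFarLaplacian r₀ r₁) z e) hz, zero_mul]
  unfold smoothingTerm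
  exact continuousOn_integral_of_compact_support hk hf hfs

/-- ★★★ D8 RESTS ON ONE NS-FREE ATOM: `HessSmoothingEnergyBound → LocalNewtonParityDoor` (B3 = fixed-time Hölder + Calderón–Zygmund
`L^{3/2}` + Sobolev `L⁶`; every Navier–Stokes / gauge / energy / continuity ingredient of the door is kernel-checked). -/
theorem localNewtonParityDoor_of_B3 (h3 : HessSmoothingEnergyBound) : LocalNewtonParityDoor :=
  localNewtonParityDoor_of_B3_B4 h3 smoothingTermContinuousInTime_holds


end Summit.NavierStokesRegularity.NavierStokesRegularity.Theorems.StrainDoors
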